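import Summits.HodgeConjecture.HodgeConjecture.Theorems.F0P3bPNullIrreducible
import Summits.HodgeConjecture.HodgeConjecture.Theorems.F0P3bGKPairGlue
import HarnessLib

/-!
# FLOOR-0 P3b «ENGINE local packets», line `F0_EngineLocalPackets` ed. 2 — STUB T6g CLOSED: `𝔭^{−δ}`-null generation
# and the `z₀`-grading of an irreducible `(𝔤, K)`-module of `U(α, β)` (thin top over the ★ generation infrastructure)

Cell hodgecm-mathlib (D-0151), FLOOR 0, crux item H413 = stmt-HodgeConjecture-24833; sub-line
`Cruxes/H413/Lines/F0_EngineLocalPackets.lean` ed. 2.x, registered stub `stub_T6g_pNullGeneration : StubT6gPNullGeneration`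
(§2 there).  PROOF lane (theorems only); author F0P3-p04 (g2) (offer 23:41Z on the F0/P3 bus, no objection).  Stub-closer
protocol (director s347): the Lines module is NOT imported; `stubT6g_holds` has the body of `StubT6gPNullGeneration` as its
TYPE, binder for binder, with the Lines-local predicate `IsPNull ρ𝔤 δ (f Y)` δ-UNFOLDED to its definiens (as the ★ T3j ∕ T6r
closers), so `theorem stub_T6g_pNullGeneration : StubT6gPNullGeneration := F0P3bStubT6gPNullGeneration.stubT6g_holds`
elaborates by `δ`.

THE ARGUMENT is F0P3-p01 (g2)'s ★ infrastructure OF RECORD, cited BY NAME: the values `E = span_ℂ {f(X)}` of the cochain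
form a NULL CORE — killed by the null operators `pOp (δ i) x_s` (the hypothesis), `𝔨`-stable (★ `lie_apply_of_mem_kInLie`),
`K`-stable (★ `gkOne_K_apply`), of `z₀`-weight `δ i` (★ `mem_upqType_iff`), non-zero (`f ≠ 0`) — so ★
`F0P3bPNullIrreducible.exists_eq_add_nat_mul_of_eigenspace_ne_bot` pins the `z₀`-spectrum of the irreducible `V` to
`{δ i + n·δ i}` (conclusion (1)) and ★ `F0P3bPNullIrreducible.eigenspace_eq_of_isNullCore` identifies the `δ i`-eigenspace
with `E` (conclusion (2)).  [cite: BorelWallach2000, II §4.1, VI Thm. 4.11] [cite: KnappVogan1995, §IV.11]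

HONEST LABEL: HC_CM is proved only modulo the printed citations until rung 0 closes; this file discharges none of them.
-/

-- Mathlib idiom (as in `GKModules`, `GKCohomology`, the `Upq*` files): commutator bracket on `Module.End`
attribute [local instance 100] LieRing.ofAssociativeRing

set_option autoImplicit false
set_option linter.dupNamespace false

noncomputable section

namespace Summit.HodgeConjecture.HodgeConjecture.Cruxes.H413.F0P3bStubT6gPNullGeneration

open Literature.Algebra.Lie Literature.Algebra.Lie.ChevalleyEilenberg
open Literature.NumberTheory.Automorphic
open Literature.RepresentationTheory.BorelWallach2000
open Literature.RepresentationTheory.KonnoKonno2007 Literature.RepresentationTheory.KonnoKonno2007.RealDualPair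
open Literature.RepresentationTheory.KonnoKonno2007.RealDualPair.UForm
open Summit.HodgeConjecture.HodgeConjecture.Cruxes.H413.F0P3bPPartOperators (pOp pOp_apply)
open Summit.HodgeConjecture.HodgeConjecture.Cruxes.H413.F0P3bPNullIrreducible (exists_eq_add_nat_mul_of_eigenspace_ne_bot
  eigenspace_eq_of_isNullCore)
open Summit.HodgeConjecture.HodgeConjecture.Cruxes.H413.F0P3bStubT6kU21PGeometry (lie_apply_of_mem_kInLie apply_lie_upqZ0
  cochainOne_eq_zero)
open Summit.HodgeConjecture.HodgeConjecture.Cruxes.H413.F0P3bGKPairGlue (gkOne_K_apply cochainOne_exists_apply_ne_zero)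

/-- **Stub T6g of `Lines/F0_EngineLocalPackets.lean` ed. 2, proved** (the body of `StubT6gPNullGeneration`, `IsPNull`
unfolded): for an irreducible `(𝔤, K)`-module of `U(α, β)` (only `hV` + `IsIrreducibleGK`) and a non-zero type-`δ`
`(𝔤, K)`-1-cochain `f` (`δ = ±1`) with `𝔭^{−δ}`-null values, (1) every `z₀`-eigenvalue is `δ(k+1) i`, `k : ℕ`, and (2) the
`δ i`-eigenspace of `z₀` lies in `span_ℂ f(𝔤)`. [cite: BorelWallach2000, II §4.1, VI Thm. 4.11] [cite: KnappVogan1995, §IV.11] -/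
theorem stubT6g_holds :
    ∀ (α β : Type) [Fintype α] [DecidableEq α] [Fintype β] [DecidableEq β]
      (V : Type) [AddCommGroup V] [Module ℂ V]
      (ρK : Representation ℂ (uFormGroup α β).maximalCompact V) (ρ𝔤 : (uFormGroup α β).lie →ₗ⁅ℝ⁆ Module.End ℂ V)
      (hV : ∀ (k : (uFormGroup α β).maximalCompact) (X : (uFormGroup α β).lie), ρK k ∘ₗ ρ𝔤 X ∘ₗ ρK k⁻¹ =
        ρ𝔤 ((uFormGroup α β).Ad (Subgroup.inclusion (uFormGroup α β).maximalCompact_le_carrier k) X)),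
      IsIrreducibleGK ρK ρ𝔤 →
      ∀ (δ : ℤ), δ = 1 ∨ δ = -1 →
      ∀ (f : Cochain ℝ (uFormGroup α β).lie (GKCarrier (uFormGroup α β) ρ𝔤) 1),
        f ∈ upqType ρK ρ𝔤 hV 1 δ → f ≠ 0 → (∀ Y : Fin 1 → (uFormGroup α β).lie,
          ∀ s : (α × β) × Fin 2, ⁅upqPBasis s, f Y⁆ + ((δ : ℂ) * Complex.I) • ⁅⁅upqZ0 α β, upqPBasis s⁆, f Y⁆ = 0) →
        (∀ (μ : ℂ) (v : GKCarrier (uFormGroup α β) ρ𝔤), v ≠ 0 → ρ𝔤 (upqZ0 α β) v = μ • v →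
            ∃ k : ℕ, μ = ((δ * ((k : ℤ) + 1) : ℤ) : ℂ) * Complex.I) ∧
        (∀ v : GKCarrier (uFormGroup α β) ρ𝔤, ρ𝔤 (upqZ0 α β) v = ((δ : ℂ) * Complex.I) • v →
            v ∈ Submodule.span ℂ (Set.range fun X : (uFormGroup α β).lie => f ![X])) := by
  intro α β _ _ _ _ V _ _ ρK ρ𝔤 hV hirr δ hδ f hf hf0 hnull
  obtain ⟨hfC, hfz⟩ := (mem_upqType_iff ρK ρ𝔤 hV 1 δ f).1 hf
  -- the scalar `μ = δ i`, `μ² = −1`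
  obtain ⟨μ, hμ⟩ : ∃ μ : ℂ, (δ : ℂ) * Complex.I = μ := ⟨_, rfl⟩
  have hδ2 : (δ : ℂ) * (δ : ℂ) = 1 := by rcases hδ with rfl | rfl <;> norm_num
  have hμ2 : μ * μ = -1 := by rw [← hμ, mul_mul_mul_comm, hδ2, Complex.I_mul_I, one_mul]
  -- the null core `E = span_ℂ {f(X)}` (values read in `V` through an `ℝ`-linear value map)
  let φ : (uFormGroup α β).lie →ₗ[ℝ] V :=
    { toFun := fun Z => (f ![Z] : V)
      map_add' := fun x y => f.map_vecCons_add ![] x y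
      map_smul' := fun r x => f.map_vecCons_smul ![] r x }
  have hφ : ∀ Y, φ Y = (f ![Y] : V) := fun _ => rfl
  obtain ⟨E, hE⟩ : ∃ E : Submodule ℂ V, Submodule.span ℂ (Set.range φ) = E := ⟨_, rfl⟩
  have hgen : ∀ X : (uFormGroup α β).lie, (f ![X] : V) ∈ E := fun X => hE ▸ Submodule.subset_span ⟨X, rfl⟩
  have hEn : ∀ e ∈ E, ∀ s : (α × β) × Fin 2, pOp ρ𝔤 μ (upqPBasis s) e = 0 := by
    intro e he s
    have hle : E ≤ LinearMap.ker (pOp ρ𝔤 μ (upqPBasis s)) := by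
      rw [← hE, Submodule.span_le]
      rintro _ ⟨X, rfl⟩
      rw [SetLike.mem_coe, LinearMap.mem_ker, hφ, pOp_apply, ← hμ]
      exact hnull ![X] s
    exact LinearMap.mem_ker.1 (hle he)
  have hEk : ∀ W ∈ (uFormGroup α β).kInLie, ∀ e ∈ E, ρ𝔤 W e ∈ E := by
    intro W hW e he
    have hle : E.map (ρ𝔤 W) ≤ E := by
      rw [← hE, Submodule.map_span_le]
      rintro _ ⟨X, rfl⟩
      rw [hφ, lie_apply_of_mem_kInLie ρK ρ𝔤 hV hfC hW X, hE]
      exact hgen _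
    exact hle (Submodule.mem_map_of_mem he)
  have hEK : ∀ (k : (uFormGroup α β).maximalCompact), ∀ e ∈ E, ρK k e ∈ E := by
    intro k e he
    have hle : E.map (ρK k) ≤ E := by
      rw [← hE, Submodule.map_span_le]
      rintro _ ⟨X, rfl⟩
      rw [hφ, gkOne_K_apply ρK ρ𝔤 hV hfC k X, hE]
      exact hgen _
    exact hle (Submodule.mem_map_of_mem he)
  have hw : ∀ e ∈ E, ρ𝔤 (upqZ0 α β) e = μ • e := by
    intro e he
    have hle : E ≤ Module.End.eigenspace (ρ𝔤 (upqZ0 α β)) μ := by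
      rw [← hE, Submodule.span_le]
      rintro _ ⟨X, rfl⟩
      rw [SetLike.mem_coe, Module.End.mem_eigenspace_iff, hφ, ← hμ]
      exact hfz ![X]
    exact Module.End.mem_eigenspace_iff.1 (hle he)
  have hne : E ≠ ⊥ := by
    obtain ⟨X, hX⟩ := cochainOne_exists_apply_ne_zero ρ𝔤 hf0
    exact fun h0 => hX ((Submodule.mem_bot ℂ).1 (h0 ▸ hgen X))
  refine ⟨fun θ v hv0 hv => ?_, fun v hv => ?_⟩
  · -- (1) spectrum pinning
    have hθ : Module.End.eigenspace (ρ𝔤 (upqZ0 α β)) θ ≠ ⊥ := by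
      refine (Submodule.ne_bot_iff _).2 ⟨(GKCarrier.of (uFormGroup α β) ρ𝔤).symm v, ?_, hv0⟩
      rw [Module.End.mem_eigenspace_iff]
      exact hv
    obtain ⟨n, hn⟩ := exists_eq_add_nat_mul_of_eigenspace_ne_bot hirr hV hμ2 hEn hEk hEK hw hne θ hθ
    refine ⟨n, ?_⟩
    rw [hn, ← hμ]
    push_cast
    ring
  · -- (2) the `δ i`-eigenspace is the core
    have heq := eigenspace_eq_of_isNullCore hirr hV hμ2 hEn hEk hEK hw hne
    have hvE : (GKCarrier.of (uFormGroup α β) ρ𝔤).symm v ∈ E := by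
      rw [← heq, Module.End.mem_eigenspace_iff, ← hμ]
      exact hv
    rw [← hE] at hvE
    exact hvE

end Summit.HodgeConjecture.HodgeConjecture.Cruxes.H413.F0P3bStubT6gPNullGeneration

end
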